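import Summits.QuantumAdvantage.QuantumAdvantage.Theorems.CubicForrelationNearExactIsExactEightLevelFour
import Summits.QuantumAdvantage.QuantumAdvantage.Theorems.CubicForrelationNearExactIsExactEightFlatRM
import Summits.QuantumAdvantage.QuantumAdvantage.Theorems.CubicForrelationNearExactIsExactEightSymplectic

/-!
# Crux `CubicForrelation.NearExactIsExact` (stmt-QuantumAdvantage-14043) — type E on 8 bits above `13/16`: PARTNER RIGIDITY OFF THE FLAT

Certificate seat `b2b-cforr-cert` (generation 2), rung `θ₈ = 13/16`.  HONEST FRAMING: a theorem about cubic Boolean functions on 8 bits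
(the finite slice `n = 8` of the crux) — NOT summit progress.

Setting (from `…EightLevelFour`): `f, g` cubic on 8 bits, `W_g = 16v`, `Φ(f,g) > 13/16`, and the even set `Z = {v even}` is a coset
`x₀ ⊕ V₀` of an `⊕`-closed `V₀` with `|V₀| = 64` (so `192` values of `v` are odd).  Write `p₁ := [⌊v/2⌋ odd]` and `s = (−1)^f`.
* `ep_p1_even`: on every parametrised 4-flat `b ⊕ ⟨a₀..a₃⟩` with `v(b)` odd and `aᵢ ∈ V₀` (it stays inside the odd region, `ep_odd_shift`)
  the number of ones of `p₁` is even — the landed flat sums `Σ_ε 2v ≡ 0 (mod 8)` (`ed_flat_sum_four`) with every `v` odd there.  The cubic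
  `f` has the same property (`ed_even_card_flat`), hence so does `h := p₁ ⊕ f` (`ep_h_even`).
* `ep_card_mismatch_lt`: where `v` is odd and `h = 1` one has `v − s ≡ 2 (mod 4)`, costing `≥ 4` in the budget
  `Σ (v − s)² = 2⁹(1−Φ) < 96`, of which the `64` even points already consume `64`: fewer than `8` such points.
* `ep_partner`: on each odd coset `x ⊕ V₀` the function `h` is even on all parametrised 4-flats and has `< 8` ones, so by the Reed–Muller
  distance on the coset (`erm_weight_ge`, `m = 6`, `r = 3`) it vanishes: **`f = [⌊v/2⌋ odd]` wherever `v` is odd.**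

References: F. J. MacWilliams, N. J. A. Sloane, *The Theory of Error-Correcting Codes* (1977), Ch. 13 §3; C. Carlet, *Boolean Functions for
Cryptography and Coding Theory*, CUP 2021, §4.1.  Everything below is proved from Mathlib and the tree; axioms are the standard three.
-/

set_option linter.dupNamespace false -- D-0017: single-problem summit ⇒ `QuantumAdvantage.QuantumAdvantage` by design

noncomputable section

namespace Summit.QuantumAdvantage.QuantumAdvantage.Theorems.CubicForrelation.NearExactIsExact

open Finset
open Literature.Computability.QuantumComplexity
open Literature.Computability.QuantumComplexity.BuzetChailloux (bxor zeroVec bxor_bxor_cancel_left bxor_zeroVec zeroVec_bxor)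
open Literature.Computability.QuantumComplexity.DerivativeWalsh (W)

/-! ### The odd region is a union of `V₀`-cosets -/

/-- If the even set of `v` is the coset `x₀ ⊕ V₀` then `v(y)` is even iff `x₀ ⊕ y ∈ V₀`. [folklore] -/
theorem ep_even_iff (v : (Fin (4 + 4) → Bool) → ℤ) (V₀ : Finset (Fin (4 + 4) → Bool)) (x₀ : Fin (4 + 4) → Bool)
    (hZ : (univ.filter fun x => ¬ Odd (v x)) = V₀.image (bxor x₀)) (y : Fin (4 + 4) → Bool) :
    ¬ Odd (v y) ↔ bxor x₀ y ∈ V₀ := by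
  have : y ∈ (univ.filter fun x => ¬ Odd (v x)) ↔ y ∈ V₀.image (bxor x₀) := by rw [hZ]
  simp only [mem_filter, mem_univ, true_and, mem_image] at this
  rw [this]
  constructor
  · rintro ⟨a, ha, rfl⟩; rwa [bxor_bxor_cancel_left]
  · intro h; exact ⟨bxor x₀ y, h, bxor_bxor_cancel_left x₀ y⟩

/-- Translating by a period keeps `v` odd. [folklore] -/
theorem ep_odd_shift (v : (Fin (4 + 4) → Bool) → ℤ) (V₀ : Finset (Fin (4 + 4) → Bool)) (x₀ : Fin (4 + 4) → Bool)
    (hadd : ∀ a ∈ V₀, ∀ b ∈ V₀, bxor a b ∈ V₀) (hZ : (univ.filter fun x => ¬ Odd (v x)) = V₀.image (bxor x₀))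
    {b a : Fin (4 + 4) → Bool} (hb : Odd (v b)) (ha : a ∈ V₀) : Odd (v (bxor b a)) := by
  by_contra hev
  have h1 := (ep_even_iff v V₀ x₀ hZ (bxor b a)).1 hev
  have h2 : bxor x₀ b ∈ V₀ := by
    have := hadd _ h1 _ ha
    rwa [show bxor (bxor x₀ (bxor b a)) a = bxor x₀ b from by
      funext j; show ((x₀ j ^^ (b j ^^ a j)) ^^ a j) = (x₀ j ^^ b j); cases a j <;> simp] at this
  exact (ep_even_iff v V₀ x₀ hZ b).2 h2 hb

/-- A `0/1`-combination of four periods is a period, and the flat point is the base translated by it. [folklore] -/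
theorem ep_comb_mem (V₀ : Finset (Fin (4 + 4) → Bool)) (h0 : zeroVec ∈ V₀) (hadd : ∀ a ∈ V₀, ∀ b ∈ V₀, bxor a b ∈ V₀)
    (a : Fin 4 → Fin (4 + 4) → Bool) (ha : ∀ i, a i ∈ V₀) (ε : Fin 4 → Bool) (b : Fin (4 + 4) → Bool) :
    ∃ c ∈ V₀, (fun j => b j ^^ decide (Odd #(univ.filter fun i => ε i && a i j))) = bxor b c := by
  have hc : ∀ i, (fun j => ε i && a i j) ∈ V₀ := by
    intro i; cases ε i
    · simp only [Bool.false_and]; exact h0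
    · simp only [Bool.true_and]; exact ha i
  refine ⟨bxor (bxor (bxor (fun j => ε 0 && a 0 j) (fun j => ε 1 && a 1 j)) (fun j => ε 2 && a 2 j)) (fun j => ε 3 && a 3 j),
    hadd _ (hadd _ (hadd _ (hc 0) _ (hc 1)) _ (hc 2)) _ (hc 3), ?_⟩
  rw [es_flatPt_four]

/-! ### The digit `p₁` and the cubic `f` are even on odd 4-flats -/

/-- **`p₁` is even on odd 4-flats.** [this work] -/
theorem ep_p1_even (g : (Fin (4 + 4) → Bool) → Bool) (hg : IsDegLeFun 3 g) (v : (Fin (4 + 4) → Bool) → ℤ)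
    (hv : ∀ x, W (fun y => signOf (g y)) x = (2 : ℝ) ^ 4 * (v x : ℝ)) (V₀ : Finset (Fin (4 + 4) → Bool))
    (x₀ : Fin (4 + 4) → Bool) (h0 : zeroVec ∈ V₀) (hadd : ∀ a ∈ V₀, ∀ b ∈ V₀, bxor a b ∈ V₀)
    (hZ : (univ.filter fun x => ¬ Odd (v x)) = V₀.image (bxor x₀)) {b : Fin (4 + 4) → Bool} (hb : Odd (v b))
    (a : Fin 4 → Fin (4 + 4) → Bool) (ha : ∀ i, a i ∈ V₀) :
    Even #(univ.filter fun ε : Fin 4 → Bool =>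
      decide (Odd (v (fun j => b j ^^ decide (Odd #(univ.filter fun i => ε i && a i j))) / 2)) = true) := by
  have hu : ∀ x, W (fun y => signOf (g y)) x = (2 : ℝ) ^ 3 * ((2 * v x : ℤ) : ℝ) := by
    intro x; rw [hv x]; push_cast; ring
  have h8 := ed_flat_sum_four g (fun x => 2 * v x) hg hu b a
  -- every point of the flat is odd
  have hodd : ∀ ε : Fin 4 → Bool, Odd (v (fun j => b j ^^ decide (Odd #(univ.filter fun i => ε i && a i j)))) := by
    intro ε
    obtain ⟨c, hc, hpt⟩ := ep_comb_mem V₀ h0 hadd a ha ε b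
    rw [hpt]
    exact ep_odd_shift v V₀ x₀ hadd hZ hb hc
  have hsplit : ∑ ε : Fin 4 → Bool, v (fun j => b j ^^ decide (Odd #(univ.filter fun i => ε i && a i j))) =
      2 * ∑ ε : Fin 4 → Bool, v (fun j => b j ^^ decide (Odd #(univ.filter fun i => ε i && a i j))) / 2 + 16 := by
    rw [mul_sum, show (16 : ℤ) = ∑ ε : Fin 4 → Bool, (1 : ℤ) by simp, ← sum_add_distrib]
    refine sum_congr rfl fun ε _ => ?_
    have := td_two_mul_div_add (v (fun j => b j ^^ decide (Odd #(univ.filter fun i => ε i && a i j))))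
    rw [if_pos (hodd ε)] at this
    linarith
  rw [← mul_sum] at h8
  have hE : Even (∑ ε : Fin 4 → Bool, v (fun j => b j ^^ decide (Odd #(univ.filter fun i => ε i && a i j))) / 2) := by
    obtain ⟨t, ht⟩ := h8
    exact ⟨t - 4, by linarith⟩
  have hE' := (tw_even_sum_iff _ _).1 hE
  simpa only [decide_eq_true_eq] using hE'

/-- **`h = p₁ ⊕ f` is even on odd 4-flats.** [this work] -/
theorem ep_h_even (f g : (Fin (4 + 4) → Bool) → Bool) (hf : IsDegLeFun 3 f) (hg : IsDegLeFun 3 g)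
    (v : (Fin (4 + 4) → Bool) → ℤ) (hv : ∀ x, W (fun y => signOf (g y)) x = (2 : ℝ) ^ 4 * (v x : ℝ))
    (V₀ : Finset (Fin (4 + 4) → Bool)) (x₀ : Fin (4 + 4) → Bool) (h0 : zeroVec ∈ V₀)
    (hadd : ∀ a ∈ V₀, ∀ b ∈ V₀, bxor a b ∈ V₀) (hZ : (univ.filter fun x => ¬ Odd (v x)) = V₀.image (bxor x₀))
    {b : Fin (4 + 4) → Bool} (hb : Odd (v b)) (a : Fin 4 → Fin (4 + 4) → Bool) (ha : ∀ i, a i ∈ V₀) :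
    Even #(univ.filter fun ε : Fin 4 → Bool =>
      (decide (Odd (v (fun j => b j ^^ decide (Odd #(univ.filter fun i => ε i && a i j))) / 2)) ^^
        f (fun j => b j ^^ decide (Odd #(univ.filter fun i => ε i && a i j)))) = true) :=
  erm_even_card_xor _ _ ((ep_p1_even g hg v hv V₀ x₀ h0 hadd hZ hb a ha).add (ed_even_card_flat f hf b a))

/-! ### The mismatch set is small -/

/-- Pointwise cost at level 4: an even `v` costs `≥ 1`, an odd `v` with `[⌊v/2⌋ odd] ≠ f` costs `≥ 4` (`v − s ≡ 2 mod 4`). [this work] -/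
theorem ep_cost_pt (a : ℤ) (b : Bool) :
    (if ¬ Odd a then (1 : ℤ) else 0) + (if Odd a ∧ (decide (Odd (a / 2)) ^^ b) = true then (4 : ℤ) else 0) ≤ (a - sZ b) ^ 2 := by
  have hsf : sZ false = 1 := rfl
  have hst : sZ true = -1 := rfl
  by_cases ho : Odd a
  · have ha1 : a % 2 = 1 := Int.odd_iff.1 ho
    rw [if_neg (not_not.2 ho), zero_add]
    split_ifs with hm
    · obtain ⟨-, hm⟩ := hm
      have key : a - sZ b ≤ -2 ∨ 2 ≤ a - sZ b := by
        cases b <;> by_cases hq : Odd (a / 2)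
        · have hq' := Int.odd_iff.1 hq
          rw [hsf]; omega
        · rw [decide_eq_false hq] at hm; exact absurd hm (by decide)
        · rw [decide_eq_true hq] at hm; exact absurd hm (by decide)
        · have hq' : a / 2 % 2 = 0 := Int.even_iff.1 (Int.not_odd_iff_even.1 hq)
          rw [hst]; omega
      exact tp_sq_ge (k := 2) (by norm_num) key
    · positivity
  · have ha0 : a % 2 = 0 := Int.even_iff.1 (Int.not_odd_iff_even.1 ho)
    rw [if_pos ho, if_neg (fun h => ho h.1), add_zero]
    have key : a - sZ b ≤ -1 ∨ 1 ≤ a - sZ b := by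
      cases b
      · rw [hsf]; omega
      · rw [hst]; omega
    exact tp_sq_ge (k := 1) (by norm_num) key

/-- **Fewer than `8` mismatches.** In type E with `Φ > 13/16` and `192` odd values: `#{x : v(x) odd, [⌊v/2⌋ odd] ≠ f(x)} < 8`. [this work] -/
theorem ep_card_mismatch_lt (f g : (Fin (4 + 4) → Bool) → Bool) (v : (Fin (4 + 4) → Bool) → ℤ)
    (hv : ∀ x, W (fun y => signOf (g y)) x = (2 : ℝ) ^ 4 * (v x : ℝ)) (hΦ : 13 / 16 < forrelation f g)
    (hN : #(univ.filter fun x => Odd (v x)) = 192) :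
    #(univ.filter fun x => Odd (v x) ∧ (decide (Odd (v x / 2)) ^^ f x) = true) < 8 := by
  have hT := el_budget4 f g v hv hΦ
  have hsum := sum_le_sum fun x (_ : x ∈ (univ : Finset (Fin (4 + 4) → Bool))) => ep_cost_pt (v x) (f x)
  rw [sum_add_distrib, sum_boole, sum_ite, sum_const_zero, add_zero, sum_const, nsmul_eq_mul] at hsum
  have h64 : #(univ.filter fun x : Fin (4 + 4) → Bool => ¬ Odd (v x)) = 64 := by
    have := card_filter_add_card_filter_not (s := (univ : Finset (Fin (4 + 4) → Bool))) (fun x => Odd (v x))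
    rw [hN, card_univ, Fintype.card_fun, Fintype.card_bool, Fintype.card_fin] at this
    simp only [Nat.reducePow, Nat.reduceAdd] at this
    exact Nat.add_left_cancel (this.trans (by norm_num))
  rw [h64] at hsum
  push_cast at hsum
  have : (#(univ.filter fun x => Odd (v x) ∧ (decide (Odd (v x / 2)) ^^ f x) = true) : ℤ) < 8 := by linarith
  exact_mod_cast this

/-! ### Partner rigidity off the flat -/

/-- **Partner rigidity on the odd region.** In type E with `Φ(f,g) > 13/16`, if the even set of `v` is a coset `x₀ ⊕ V₀` of an
`⊕`-closed `V₀` of size `64` and `192` values are odd, then `f(x) = [⌊v(x)/2⌋ odd]` at every `x` with `v(x)` odd (Reed–Muller distance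
on each odd coset). [this work] -/
theorem ep_partner (f g : (Fin (4 + 4) → Bool) → Bool) (hf : IsDegLeFun 3 f) (hg : IsDegLeFun 3 g)
    (v : (Fin (4 + 4) → Bool) → ℤ) (hv : ∀ x, W (fun y => signOf (g y)) x = (2 : ℝ) ^ 4 * (v x : ℝ))
    (hΦ : 13 / 16 < forrelation f g) (V₀ : Finset (Fin (4 + 4) → Bool)) (x₀ : Fin (4 + 4) → Bool) (h0 : zeroVec ∈ V₀)
    (hadd : ∀ a ∈ V₀, ∀ b ∈ V₀, bxor a b ∈ V₀) (hcard : #V₀ = 64)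
    (hZ : (univ.filter fun x => ¬ Odd (v x)) = V₀.image (bxor x₀)) (hN : #(univ.filter fun x => Odd (v x)) = 192) :
    ∀ x, Odd (v x) → f x = decide (Odd (v x / 2)) := by
  classical
  intro x hx
  by_contra hne
  have hhx : (decide (Odd (v x / 2)) ^^ f x) = true := by
    revert hne; cases f x <;> cases decide (Odd (v x / 2)) <;> simp
  have hlt := ep_card_mismatch_lt f g v hv hΦ hN
  -- the odd coset of `x`
  have hflat : ∀ b ∈ V₀.image (bxor x), ∀ a : Fin (3 + 1) → Fin (4 + 4) → Bool, (∀ i, a i ∈ V₀) →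
      Even #(univ.filter fun ε : Fin (3 + 1) → Bool => (decide (Odd (v (fun j => b j ^^
        decide (Odd #(univ.filter fun i => ε i && a i j))) / 2)) ^^
          f (fun j => b j ^^ decide (Odd #(univ.filter fun i => ε i && a i j)))) = true) := by
    intro b hb a ha
    obtain ⟨c, hc, rfl⟩ := mem_image.1 hb
    exact ep_h_even f g hf hg v hv V₀ x₀ h0 hadd hZ (ep_odd_shift v V₀ x₀ hadd hZ hx hc) a ha
  have hxin : x ∈ V₀.image (bxor x) := mem_image.2 ⟨zeroVec, h0, bxor_zeroVec x⟩
  have hge := erm_weight_ge 6 3 V₀ h0 hadd (by rw [hcard]; norm_num) x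
    (fun y => decide (Odd (v y / 2)) ^^ f y) hflat ⟨x, hxin, hhx⟩
  have hsub : ((V₀.image (bxor x)).filter fun y => (decide (Odd (v y / 2)) ^^ f y) = true) ⊆
      univ.filter fun y => Odd (v y) ∧ (decide (Odd (v y / 2)) ^^ f y) = true := by
    intro y hy
    obtain ⟨hy1, hy2⟩ := mem_filter.1 hy
    obtain ⟨c, hc, rfl⟩ := mem_image.1 hy1
    exact mem_filter.2 ⟨mem_univ _, ep_odd_shift v V₀ x₀ hadd hZ hx hc, hy2⟩
  have h7 : #(univ.filter fun y => Odd (v y) ∧ (decide (Odd (v y / 2)) ^^ f y) = true) ≤ 7 := by omega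
  have h56 : 2 ^ 6 ≤ 2 ^ 3 * 7 := hge.trans (Nat.mul_le_mul_left _ ((card_le_card hsub).trans h7))
  norm_num at h56

end Summit.QuantumAdvantage.QuantumAdvantage.Theorems.CubicForrelation.NearExactIsExact

end
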